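import Literature.MathematicalPhysics.QuantumFieldTheory.Balaban1983to89.B11Ineq73KernelLettersPerLattice
import Literature.Analysis.Complex.CauchyTaylorBall
import Literature.Analysis.Complex.HolomorphicTaylorApprox

/-!
# `Balaban1983to89.B11Eq56CubicRemainderUniform` — T. Bałaban, *The variational problem and background fields in renormalization group method
# for lattice gauge theories*, Commun. Math. Phys. **102** (1985) 277–309 [Balaban1985Variational]: (55)–(57) p. 286, (78) p. 290 — THE ORDER-THREE
# TAYLOR REMAINDER OF THE LETTER `C` AND THE CUBIC BOUND ON `HD₃ = HD − HC⁽²⁾` IN CLOSED FORM FROM `(C₂, c₄)` AND THE SECT. C REGIME ALONE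
# (Cauchy's estimate on complex lines) — the per-lattice `∃ K₃ r₁ γ R₃` of `B11Ineq73KernelLettersPerLattice` §4 made UNIFORM over every family of
# letters `C` obeying ONE quadratic bound `‖C(Y)‖ ≤ C₂‖Y‖²` on ONE ball `‖Y‖ < c₄`

statement-level skeleton of published theorems with citation tags; proofs where landed; nothing here is a claim about the Yang–Mills mass gap

THE PRINT (verbatim).  p. 286 (55): *«|D(A′)| … ≦ 4C₂|A′|²₍₋₁₎. (55) This implies that a power series expansion of D(A′) begins with second order
terms»*, (56) *«D^{(2)}(A′) = C_j^{(2)}(LʲηA′)»*; p. 290 (78): *«⟨HD(A′), J⟩ = ⟨HC^{(2)}(A′), J⟩ + ⟨HD₃(A′), J⟩»*; p. 289 after (73): *«If we subtract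
these terms from 𝔇(A′), then we get an operator 𝔇₂(A′) for which we have the bound (73) with ε₃² instead of ε₃.»*  The constants of (73) depend on
«d and L only» ((97) p. 293); THIS FILE supplies the step of that uniformity which is plain complex analysis: the order-≥ 3 tail of an analytic
function with a UNIFORM quadratic bound on a FIXED ball is cubic with a constant depending on `(C₂, c₄)` ONLY (Cauchy's inequality for the Taylor
coefficients on the complex line through `0` and `Z`, [HormanderSCV1973] Thm 2.2.7) — NOT print's decay, NOT its lattice-uniformity.

WHY THIS FILE (cell context, pub-balaban NE9).  NE9 leaf-01's `B11Ineq73KernelLettersPerLattice.exists_cubic_remainder` produces the cubic Taylor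
remainder of `C` by `HasFPowerSeriesAt.isBigO_sub_partialSum_pow` — an `∃ r₁ K₃` depending on the FUNCTION `C`, hence, at the NE9 chain's letters
`C(U) = Cc L m η U …`, on the BACKGROUND `U`; the kernel letter `θ₃` of the W-slot's (98)-constant `C₄` inherits this dependence, so the one-instance
chart's radii (`Support/NE9CurChartOneInstanceSmallField`, T24) cannot be chosen before `∀ U`.  With the closed form below, `θ₃` becomes a function
of `(b, C₂, c₄, a_C, ε_C)` and the lattice (sequel `B11Ineq73KernelLettersUniform`), and the uniform-ball species
`Support/NE9CurChartOneInstanceUniformBall` loses its displayed `C₄`.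

WHAT IS PROVED (sorry-free; no definition; no `Prop` placeholder; nothing of [B11]'s inequalities asserted).
* §1 **`norm_sub_quad_le_cubic`** (generic finite-dimensional complex domain `E`, complete codomain): `‖C(Y)‖ ≤ C₂‖Y‖²` and `DifferentiableOn ℂ C`
  on `‖Y‖ < c₄` ⇒ `‖C Z − ½D²C(0)(Z,Z)‖ ≤ (16C₂∕c₄)·‖Z‖³` for `‖Z‖ ≤ c₄∕4` — the slice `t ↦ C(tZ)` is holomorphic on `|t| < c₄∕‖Z‖` with sup `≤ C₂c₄²`;
  `Literature.Analysis.Complex.norm_sub_taylor_le_of_forall_mem_ball` (order 3) and `iteratedDeriv_slice_zero`; the `n = 0, 1` Taylor terms vanish by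
  `B12SecondOrder267.eq_zero_of_norm_le_sq` ∕ `fderiv_zero_of_norm_le_sq`.
* §2 **`norm_sub_le_of_quad`**: the same hypotheses ⇒ `‖C A − C Y‖ ≤ 4C₂ρ·‖A − Y‖` for `‖A‖, ‖Y‖ ≤ ρ < c₄∕2` (mean value inequality on the closed
  ball with Cauchy's power-form bound `‖DC(x)‖ ≤ 4C₂‖x‖` of `B11Ineq73KernelLettersPerLattice.norm_fderiv_le_of_pow_bound`).
* §3 **`norm_E3_le_cubic`** — THE CUBIC VALUE BOUND ON `HD₃` IN CLOSED FORM: under `Regime H 0 C b 0 C₂ c₄ 0 a_C ε_C` and `Prop4Hyp C C₂ c₄`, with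
  `ℓ = 1∕(1 − 4bC₂(ε_C + a_C))`, for `‖A′‖ < min a_C (c₄∕(2(ℓ+1)))`:
  `‖HD₃(A′)‖ ≤ b·(4C₂(ℓ+1)·bC₂ℓ² + 16C₂∕c₄)·‖A′‖³` — from `HD₃(A′) = H[C(A) − C(A′)] + H[C(A′) − C⁽²⁾(A′)]`, `A = T47 A′` (‖A‖ ≤ ℓ‖A′‖,
  `‖A − A′‖ = ‖HD(A′)‖ ≤ bC₂ℓ²‖A′‖²`), §2 on the ball of radius `(ℓ+1)‖A′‖` and §1 at `A′`.  No second-order chain rule, no operator norm of `D²C(0)`.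
HONEST SCOPE.  (i) Constants closed-form in `(b, C₂, c₄, a_C, ε_C)`; at the NE9 chain's letters these are per-LATTICE numbers (leaf-03's `C₂ = 2097152(d+1)²`,
`c₄ = 1∕(512(d+1))` are d-only; `b`, `a_C`, `ε_C` per lattice) — uniform in the BACKGROUND at a fixed lattice, NOT in the lattice.  (ii) Nothing of (73)'s
decay.  (iii) NOT summit progress (cell pub-balaban: NE9 NOT PRINTED ∕ NOT PROVED; «NE9 ⇐ the named binders»; spine PROVED 0∕9; HONEST DEPENDENCY:
continuum YM on T⁴ ⇐ BetaPertH ∧ nine spine estimates (0/9 proved); BetaPertH ⇐ (D1) ∧ (D4) ∧ CAP+tail; G-an2-4 gates asym, D1 and NE2/3/4).  Filed by the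
NE9 crux-team leaf seat `b2b-balaban-t4-ne9-formalise-leaf-05` (gen 68); NEW file; imports `B11Ineq73KernelLettersPerLattice` (NE9 leaf-01),
`Literature.Analysis.Complex.CauchyTaylorBall`, `Literature.Analysis.Complex.HolomorphicTaylorApprox`; nothing modified.  Net new unproved facts: 0.
-/

noncomputable section

open scoped BigOperators Nat
namespace Literature.MathematicalPhysics.QuantumFieldTheory.Balaban1983to89.B11Eq56CubicRemainderUniform

open Metric Set Filter Topology
open Literature.MathematicalPhysics.QuantumFieldTheory.Balaban1983to89.B11Prop6Scheme (Prop4Hyp)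
open Literature.MathematicalPhysics.QuantumFieldTheory.Balaban1983to89.B11Eq174Chart (Regime)
open Literature.MathematicalPhysics.QuantumFieldTheory.Balaban1983to89.B11Eq90V0GroupComposed (T47 norm_T47_le)
open Literature.MathematicalPhysics.QuantumFieldTheory.Balaban1983to89.B11Eq80Current (Emap E3 quadPart Emap_eq_H Emap_eq_sub)
open Literature.MathematicalPhysics.QuantumFieldTheory.Balaban1983to89.B11Eq98CurrentSlot (norm_Emap_le_sq)
open Literature.MathematicalPhysics.QuantumFieldTheory.Balaban1983to89.B12SecondOrder267 (eq_zero_of_norm_le_sq fderiv_zero_of_norm_le_sq)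
open Literature.MathematicalPhysics.QuantumFieldTheory.Balaban1983to89.B11Ineq73KernelLettersPerLattice (norm_fderiv_le_of_pow_bound)
open B9SectCLatticeCarrier (Bond)
open B11Eq115Space

/-! ## §1 The order-three Taylor remainder of a quadratically bounded analytic map, in closed form -/

section Generic

variable {E F : Type*} [NormedAddCommGroup E] [NormedSpace ℂ E] [FiniteDimensional ℂ E] [NormedAddCommGroup F] [NormedSpace ℂ F]
  [CompleteSpace F]

/-- **THE CUBIC TAYLOR REMAINDER FROM A QUADRATIC BOUND ON A BALL, CLOSED FORM**: if `‖C(Y)‖ ≤ C₂‖Y‖²` and `C` is complex-differentiable on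
`‖Y‖ < c₄`, then `‖C Z − ½·D²C(0)(Z, Z)‖ ≤ (16C₂∕c₄)·‖Z‖³` for `‖Z‖ ≤ c₄∕4`.  Proof: the slice `t ↦ C(tZ)` is holomorphic on the disc `|t| < c₄∕‖Z‖`
(radius `≥ 4`) with sup `≤ C₂c₄²`; the order-3 Taylor remainder at `t = 1` is `≤ 2(C₂c₄²)(2‖Z‖∕c₄)³` (`Literature.Analysis.Complex.
norm_sub_taylor_le_of_forall_mem_ball`); the Taylor coefficients of the slice at `0` are `DⁿC(0)(Z,…,Z)∕n!` (`iteratedDeriv_slice_zero`), and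
`C(0) = 0`, `DC(0) = 0` by the quadratic bound.  Print: (55)–(56) «a power series expansion of D(A′) begins with second order terms … D⁽²⁾ = C⁽²⁾»,
the order-≥ 3 tail made quantitative. [cite: Balaban1985Variational, (55)–(56) p.286; HormanderSCV1973, Thm 2.2.7] -/
theorem norm_sub_quad_le_cubic {C : E → F} {C₂ c₄ : ℝ} (hc₄ : 0 < c₄) (hq : ∀ Y : E, ‖Y‖ < c₄ → ‖C Y‖ ≤ C₂ * ‖Y‖ ^ 2)
    (hd : DifferentiableOn ℂ C {Y : E | ‖Y‖ < c₄}) {Z : E} (hZ : ‖Z‖ ≤ c₄ / 4) :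
    ‖C Z - (2 : ℂ)⁻¹ • iteratedFDeriv ℂ 2 C 0 (fun _ => Z)‖ ≤ 16 * C₂ / c₄ * ‖Z‖ ^ 3 := by
  have h0 : C 0 = 0 := eq_zero_of_norm_le_sq hc₄ hq
  have h1 : fderiv ℂ C 0 = 0 := fderiv_zero_of_norm_le_sq (𝕜 := ℂ) hc₄ hq
  rcases eq_or_ne Z 0 with rfl | hZne
  · have h2 : iteratedFDeriv ℂ 2 C 0 (fun _ => (0 : E)) = 0 :=
      (iteratedFDeriv ℂ 2 C 0).map_coord_zero (0 : Fin 2) rfl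
    rw [h0, h2, smul_zero, sub_zero, norm_zero, norm_zero]
    simp
  have hZ0 : 0 < ‖Z‖ := norm_pos_iff.2 hZne
  have hC₂ : 0 ≤ C₂ := by
    by_contra hneg
    have hneg : C₂ < 0 := not_le.mp hneg
    have h := hq Z (by linarith)
    have : C₂ * ‖Z‖ ^ 2 < 0 := mul_neg_of_neg_of_pos hneg (by positivity)
    linarith [norm_nonneg (C Z)]
  have hU : IsOpen {Y : E | ‖Y‖ < c₄} := isOpen_lt continuous_norm continuous_const
  have hcU : (0 : E) ∈ {Y : E | ‖Y‖ < c₄} := by simpa using hc₄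
  -- the slice through `0` in the direction `Z`, holomorphic on the disc of radius `R = c₄ / ‖Z‖ ≥ 4`
  set R : ℝ := c₄ / ‖Z‖ with hR
  have hR4 : 4 ≤ R := by rw [hR, le_div_iff₀ hZ0]; linarith
  have hR0 : 0 < R := by linarith
  set sl : ℂ → F := fun t => C (0 + t • Z) with hsl
  have hmem : ∀ t : ℂ, t ∈ ball (0 : ℂ) R → ‖(0 : E) + t • Z‖ < c₄ := by
    intro t ht
    rw [mem_ball, dist_zero_right] at ht
    rw [zero_add, norm_smul]
    calc ‖t‖ * ‖Z‖ < R * ‖Z‖ := mul_lt_mul_of_pos_right ht hZ0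
      _ = c₄ := by rw [hR]; field_simp
  have hsld : DifferentiableOn ℂ sl (ball (0 : ℂ) R) := by
    intro t ht
    have hx : (0 : E) + t • Z ∈ {Y : E | ‖Y‖ < c₄} := hmem t ht
    exact ((hd _ hx).differentiableAt (hU.mem_nhds hx)).comp_differentiableWithinAt t (by fun_prop)
  have hM : ∀ t ∈ ball (0 : ℂ) R, ‖sl t‖ ≤ C₂ * c₄ ^ 2 := by
    intro t ht
    have hx := hmem t ht
    calc ‖sl t‖ ≤ C₂ * ‖(0 : E) + t • Z‖ ^ 2 := hq _ hx
      _ ≤ C₂ * c₄ ^ 2 := by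
          refine mul_le_mul_of_nonneg_left ?_ hC₂
          exact pow_le_pow_left₀ (norm_nonneg _) hx.le 2
  -- the order-three Taylor remainder of the slice at `t = 1`
  have h := Literature.Analysis.Complex.norm_sub_taylor_le_of_forall_mem_ball (c := (0 : ℂ)) hR0 hsld hM (z := 1)
    (by rw [sub_zero, norm_one]; linarith) 3
  have hslice : ∀ n, iteratedDeriv n sl 0 = iteratedFDeriv ℂ n C 0 fun _ => Z := fun n =>
    Literature.Analysis.Complex.iteratedDeriv_slice_zero hd hU hcU Z n
  simp only [hslice, Finset.sum_range_succ, Finset.sum_range_zero, zero_add, sub_zero, one_pow, one_smul, Nat.factorial_zero,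
    Nat.cast_one, inv_one, iteratedFDeriv_zero_apply, h0, Nat.factorial_one, iteratedFDeriv_one_apply, h1,
    _root_.zero_apply, Nat.factorial_two, Nat.cast_ofNat, norm_one, mul_one] at h
  have hsl1 : sl 1 = C Z := by simp [hsl]
  rw [hsl1] at h
  refine h.trans (le_of_eq ?_)
  rw [hR]
  field_simp
  ring

/-! ## §2 A Lipschitz bound near the critical point from the quadratic bound -/

omit [FiniteDimensional ℂ E] [CompleteSpace F] in
/-- **A LIPSCHITZ BOUND NEAR THE CRITICAL POINT FROM THE QUADRATIC BOUND**: `‖C(Y)‖ ≤ C₂‖Y‖²` (with `0 ≤ C₂`) and differentiability on `‖Y‖ < c₄`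
give `‖C A − C Y‖ ≤ 4C₂ρ·‖A − Y‖` whenever `‖A‖, ‖Y‖ ≤ ρ < c₄∕2`: Cauchy's power-form estimate `‖DC(x)‖ ≤ C₂c₄²∕((c₄∕2)(c₄∕2))·‖x‖ = 4C₂‖x‖` on
`‖x‖ < c₄∕2` (`norm_fderiv_le_of_pow_bound`, `n = 1`) and the mean value inequality on the closed ball of radius `ρ`.
[cite: Balaban1985Variational, (53)–(55) p.286] -/
theorem norm_sub_le_of_quad {C : E → F} {C₂ c₄ : ℝ} (hc₄ : 0 < c₄) (hC₂ : 0 ≤ C₂) (hq : ∀ Y : E, ‖Y‖ < c₄ → ‖C Y‖ ≤ C₂ * ‖Y‖ ^ 2)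
    (hd : DifferentiableOn ℂ C {Y : E | ‖Y‖ < c₄}) {ρ : ℝ} (hρ : ρ < c₄ / 2) {A Y : E} (hA : ‖A‖ ≤ ρ) (hY : ‖Y‖ ≤ ρ) :
    ‖C A - C Y‖ ≤ 4 * C₂ * ρ * ‖A - Y‖ := by
  have hρ0 : 0 ≤ ρ := (norm_nonneg _).trans hA
  have hU : IsOpen {Y : E | ‖Y‖ < c₄} := isOpen_lt continuous_norm continuous_const
  have hd' : DifferentiableOn ℂ C (ball (0 : E) c₄) := by rwa [ball_zero_eq]
  have hq' : ∀ z : E, ‖z‖ < c₄ → ‖C z‖ ≤ C₂ * ‖z‖ ^ (1 + 1) := fun z hz => by simpa using hq z hz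
  -- the derivative bound on the closed ball of radius `ρ`
  have hder : ∀ x ∈ closedBall (0 : E) ρ, ‖fderiv ℂ C x‖ ≤ 4 * C₂ * ρ := by
    intro x hx
    rw [mem_closedBall, dist_zero_right] at hx
    rcases eq_or_ne x 0 with rfl | hx0
    · rw [fderiv_zero_of_norm_le_sq (𝕜 := ℂ) hc₄ hq, norm_zero]; positivity
    · have h := norm_fderiv_le_of_pow_bound (n := 1) hd' hC₂ hq' (by positivity : (0 : ℝ) < c₄ / 2) (by linarith) hx0
        (lt_of_le_of_lt hx hρ)
      have heq : C₂ * c₄ ^ (1 + 1) / ((c₄ / 2) ^ 1 * (c₄ - c₄ / 2)) = 4 * C₂ := by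
        field_simp
        ring
      rw [heq, pow_one] at h
      calc ‖fderiv ℂ C x‖ ≤ 4 * C₂ * ‖x‖ := h
        _ ≤ 4 * C₂ * ρ := by gcongr
  have hdiff : ∀ x ∈ closedBall (0 : E) ρ, DifferentiableAt ℂ C x := by
    intro x hx
    rw [mem_closedBall, dist_zero_right] at hx
    have hx' : x ∈ {Y : E | ‖Y‖ < c₄} := by
      show ‖x‖ < c₄
      linarith
    exact (hd x hx').differentiableAt (hU.mem_nhds hx')
  have hAm : A ∈ closedBall (0 : E) ρ := by rwa [mem_closedBall, dist_zero_right]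
  have hYm : Y ∈ closedBall (0 : E) ρ := by rwa [mem_closedBall, dist_zero_right]
  exact (convex_closedBall (0 : E) ρ).norm_image_sub_le_of_norm_fderiv_le hdiff hder hYm hAm

end Generic

/-! ## §3 The cubic value bound on `HD₃ = HD − HC⁽²⁾` with a closed-form constant -/

section Cubic

variable {𝔸 : Type*} [NormedRing 𝔸] [NormedAlgebra ℂ 𝔸] [FiniteDimensional ℂ 𝔸]
variable {d : ℕ} {Pd : Fin d → ℕ} {L η : ℝ} [Fact (0 < L)] [Fact (0 < η)] {lev₀ : Bond d Pd → ℕ} {κ' : Type*} [Fintype κ']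
  {lev₁ : κ' → ℕ} {Dc : (Bond d Pd → 𝔸) →ₗ[ℂ] (κ' → 𝔸)}
variable {𝒳 : Type*} [NormedAddCommGroup 𝒳] [NormedSpace ℂ 𝒳]
variable {H : 𝒳 →L[ℂ] Space115 L η lev₀ lev₁ Dc} {C : Space115 L η lev₀ lev₁ Dc → 𝒳} {b C₂ c₄ aC εC : ℝ}

/-- **`‖HD₃(A′)‖ ≤ γ·‖A′‖³` WITH `γ`, `R₃` IN CLOSED FORM** (print's «the part of D of order ≥ 3», (78), (56) «D⁽²⁾ = C⁽²⁾»): under the Sect. C regime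
and `Prop4Hyp C C₂ c₄`, with `ℓ = 1∕(1 − 4bC₂(ε_C + a_C))`, for every `‖A′‖ < min a_C (c₄∕(2(ℓ+1)))`:
`‖HD₃(A′)‖ ≤ b·(4C₂(ℓ+1)·(bC₂ℓ²) + 16C₂∕c₄)·‖A′‖³`.  Decomposition `HD₃(A′) = H[C(A) − C(A′)] + H[C(A′) − C⁽²⁾(A′)]` with `A = T47 A′`
(`Emap_eq_H`); the first bracket by §2's Lipschitz bound on the ball of radius `(ℓ+1)‖A′‖` (‖A‖ ≤ ℓ‖A′‖, `norm_T47_le`) times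
`‖A − A′‖ = ‖HD(A′)‖ ≤ bC₂ℓ²‖A′‖²` (`norm_Emap_le_sq`); the second by §1's cubic remainder (‖A′‖ ≤ c₄∕4 since ℓ ≥ 1).  VALUE level only; the per-lattice
`∃ R₃ γ` of `B11Ineq73KernelLettersPerLattice.exists_cubic_bound_E3` with the quantifier on the function `C` REMOVED.
[cite: Balaban1985Variational, (78) p.290, (55)–(57) p.286] -/
theorem norm_E3_le_cubic [CompleteSpace 𝒳] [CompleteSpace 𝔸] (RC : Regime H 0 C b 0 C₂ c₄ 0 aC εC) (hC : Prop4Hyp C C₂ c₄)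
    {Y : Space115 L η lev₀ lev₁ Dc}
    (hY : ‖Y‖ < min aC (c₄ / (2 * (1 / (1 - 4 * b * C₂ * (εC + aC)) + 1)))) :
    ‖E3 H C εC Y‖ ≤ b * (4 * C₂ * (1 / (1 - 4 * b * C₂ * (εC + aC)) + 1) * (b * C₂ * (1 / (1 - 4 * b * C₂ * (εC + aC))) ^ 2)
      + 16 * C₂ / c₄) * ‖Y‖ ^ 3 := by
  set ℓ : ℝ := 1 / (1 - 4 * b * C₂ * (εC + aC)) with hℓ
  have hq : 0 < 1 - 4 * b * C₂ * (εC + aC) := by linarith [RC.contr]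
  have haC : 0 < aC := lt_of_le_of_lt (norm_nonneg Y) (lt_of_lt_of_le hY (min_le_left _ _))
  have hbC : 0 ≤ b * C₂ := mul_nonneg RC.B₀_nonneg RC.C₄_nonneg
  have hqnn : 0 ≤ 4 * b * C₂ * (εC + aC) := by
    have := RC.ε₄_nonneg
    have : 0 ≤ εC + aC := by linarith
    nlinarith
  have hℓ1 : 1 ≤ ℓ := by
    rw [hℓ, le_div_iff₀ hq]; linarith
  have hℓ0 : 0 < ℓ := by linarith
  have hc₄ : 0 < c₄ := by linarith [RC.dom, RC.ε₄_nonneg]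
  have hYa : ‖Y‖ < aC := lt_of_lt_of_le hY (min_le_left _ _)
  have hYc : ‖Y‖ < c₄ / (2 * (ℓ + 1)) := lt_of_lt_of_le hY (min_le_right _ _)
  have hY2 : ‖Y‖ * (2 * (ℓ + 1)) < c₄ := (lt_div_iff₀ (by positivity)).1 hYc
  have hY4 : ‖Y‖ ≤ c₄ / 4 := by
    rw [le_div_iff₀ (by norm_num : (0 : ℝ) < 4)]
    nlinarith [norm_nonneg Y]
  -- `A = T47 Y`: `‖A‖ ≤ ℓ‖Y‖`, `‖A − Y‖ ≤ bC₂ℓ²‖Y‖²`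
  have hA : ‖T47 H C εC Y‖ ≤ ℓ * ‖Y‖ := by rw [hℓ, one_div_mul_eq_div]; exact norm_T47_le RC hYa
  have hAY : ‖T47 H C εC Y - Y‖ ≤ b * C₂ * ℓ ^ 2 * ‖Y‖ ^ 2 := by
    rw [show T47 H C εC Y - Y = -Emap H C εC Y by rw [Emap_eq_sub]; abel, norm_neg, hℓ]
    exact norm_Emap_le_sq RC hYa
  -- the Lipschitz bound on the closed ball of radius `(ℓ + 1)‖Y‖ < c₄/2`
  have hρ : (ℓ + 1) * ‖Y‖ < c₄ / 2 := by nlinarith [norm_nonneg Y]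
  have hCAY : ‖C (T47 H C εC Y) - C Y‖ ≤ 4 * C₂ * ((ℓ + 1) * ‖Y‖) * ‖T47 H C εC Y - Y‖ :=
    norm_sub_le_of_quad hc₄ RC.C₄_nonneg hC.quad hC.differentiableOn hρ (hA.trans (by nlinarith [norm_nonneg Y]))
      (by nlinarith [norm_nonneg Y])
  -- the cubic Taylor remainder of `C` at `Y`
  have hrem : ‖C Y - quadPart C Y‖ ≤ 16 * C₂ / c₄ * ‖Y‖ ^ 3 :=
    norm_sub_quad_le_cubic hc₄ hC.quad hC.differentiableOn hY4
  -- the decomposition `HD₃(Y) = H[C(A) − C(Y)] + H[C(Y) − C⁽²⁾(Y)]`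
  have hdec : E3 H C εC Y = H (C (T47 H C εC Y) - C Y) + H (C Y - quadPart C Y) := by
    rw [E3, Emap_eq_H RC hYa, map_sub, map_sub]; abel
  rw [hdec]
  have h1 : ‖H (C (T47 H C εC Y) - C Y)‖ ≤ b * (4 * C₂ * (ℓ + 1) * (b * C₂ * ℓ ^ 2)) * ‖Y‖ ^ 3 := by
    calc _ ≤ b * ‖C (T47 H C εC Y) - C Y‖ := RC.norm_G _
      _ ≤ b * (4 * C₂ * ((ℓ + 1) * ‖Y‖) * ‖T47 H C εC Y - Y‖) := mul_le_mul_of_nonneg_left hCAY RC.B₀_nonneg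
      _ ≤ b * (4 * C₂ * ((ℓ + 1) * ‖Y‖) * (b * C₂ * ℓ ^ 2 * ‖Y‖ ^ 2)) := by
          refine mul_le_mul_of_nonneg_left (mul_le_mul_of_nonneg_left hAY ?_) RC.B₀_nonneg
          have := RC.C₄_nonneg
          positivity
      _ = b * (4 * C₂ * (ℓ + 1) * (b * C₂ * ℓ ^ 2)) * ‖Y‖ ^ 3 := by ring
  have h2 : ‖H (C Y - quadPart C Y)‖ ≤ b * (16 * C₂ / c₄) * ‖Y‖ ^ 3 := by
    calc _ ≤ b * ‖C Y - quadPart C Y‖ := RC.norm_G _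
      _ ≤ b * (16 * C₂ / c₄ * ‖Y‖ ^ 3) := mul_le_mul_of_nonneg_left hrem RC.B₀_nonneg
      _ = b * (16 * C₂ / c₄) * ‖Y‖ ^ 3 := by ring
  calc _ ≤ ‖H (C (T47 H C εC Y) - C Y)‖ + ‖H (C Y - quadPart C Y)‖ := norm_add_le _ _
    _ ≤ b * (4 * C₂ * (ℓ + 1) * (b * C₂ * ℓ ^ 2)) * ‖Y‖ ^ 3 + b * (16 * C₂ / c₄) * ‖Y‖ ^ 3 := add_le_add h1 h2
    _ = _ := by ring

omit [FiniteDimensional ℂ 𝔸] in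
/-- The radius of §3 is positive and at most `a_C` (so the cubic bound lives inside the Sect. C regime's ball, where `HD₃` is analytic).
[cite: Balaban1985Variational, (62) p.287] -/
theorem cubicRadius_pos (RC : Regime H 0 C b 0 C₂ c₄ 0 aC εC) (haC : 0 < aC) :
    0 < min aC (c₄ / (2 * (1 / (1 - 4 * b * C₂ * (εC + aC)) + 1))) ∧
      min aC (c₄ / (2 * (1 / (1 - 4 * b * C₂ * (εC + aC)) + 1))) ≤ aC := by
  have hq : 0 < 1 - 4 * b * C₂ * (εC + aC) := by linarith [RC.contr]
  have hc₄ : 0 < c₄ := by linarith [RC.dom, RC.ε₄_nonneg]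
  have hℓ0 : 0 < 1 / (1 - 4 * b * C₂ * (εC + aC)) := by positivity
  exact ⟨lt_min haC (by positivity), min_le_left _ _⟩

omit [FiniteDimensional ℂ 𝔸] in
/-- The constant of §3 is non-negative (`0 < a_C`, so that `0 < c₄` by the regime's `2(ε_C + a_C) ≤ c₄`). [cite: Balaban1985Variational, (78) p.290] -/
theorem cubicConst_nonneg (RC : Regime H 0 C b 0 C₂ c₄ 0 aC εC) (haC : 0 < aC) :
    0 ≤ b * (4 * C₂ * (1 / (1 - 4 * b * C₂ * (εC + aC)) + 1) * (b * C₂ * (1 / (1 - 4 * b * C₂ * (εC + aC))) ^ 2)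
      + 16 * C₂ / c₄) := by
  have hq : 0 < 1 - 4 * b * C₂ * (εC + aC) := by linarith [RC.contr]
  have hc₄ : 0 < c₄ := by linarith [RC.dom, RC.ε₄_nonneg, haC]
  have hb := RC.B₀_nonneg
  have hC₂ := RC.C₄_nonneg
  positivity

end Cubic

end Literature.MathematicalPhysics.QuantumFieldTheory.Balaban1983to89.B11Eq56CubicRemainderUniform

end
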